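import Summits.AtomisticToContinuum.Crystallization.Theorems.OverbindingBudgetScaleWidening

/-!
# OverbindingBudget — ONE-CURRENCY certificate targets for slots 4 and 5: `TwoShellShape` (lens-5 / census currency) and `BarlowGluingW` (lens-4 g29, part XVII)

Helper file (`--supports stmt-AtomisticToContinuum-31280`).  Critic row 438 (6)(B)(C): state the metric slot 4 and the chart slot 5 of the
RDEF cone in the currency the other seats certify / prove in, with the seams PROVED here so that nothing is lost in translation.

* §1 **Slot 4 in lens-5 currency.**  `TwoShellShape θ ε g`: at a site `i` of an injective `7/10`-separated finite configuration all of whose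
  sites within `(5/2)·nn_i` are charge-free(θ) (`nn_i = nearestDist y i`; this covers `i`, its bonded dozen and their dozens), the
  configuration is `(ε, gap g)`-TWO-SHELL-GOOD at `i` AT SCALE `nn_i`: an fcc or hcp two-shell pattern (12 + 6 caps) fits within `ε·nn_i`,
  injectively, and covers every site within `(3/2 + g)·nn_i`.  SCALE-FREE (no `a′`-window: R1-N built in), over `Fin N → E3` /
  `bondGraph θ` / `IsChargeFree θ` exactly like lens-5's `KR2Shape` (its 12-point first-shell shadow) and `CappedRigidity`; the census's
  KR157 / TAG 160 instruments report its sup directly (18-point deviation at scale `nn_i`).  SEAM, PROVED (§1, `T₀ ≤ 1/250`):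
  `TwoShellShape (1/100) (3/50) (1/450) → LocalTwoShellRigidityW T₀ D` (the clean class pins `nn_i ∈ [0.917, 1.024] ⊂ [9/10, 103/100]`,
  chunk sites are `0.917 ≥ 7/10` separated, `(5/2)·nn_i ≤ 3`, and `1/500 ≤ nn_i/450`).
* §2 **Slot 5 class-free.**  `BarlowGluingW`: a rooted uniformly discrete set all of whose sites are `(1/16, 9/10, 103/100)`-two-shell-good is
  Barlow-bond-charted (`IsCharted (μS Y)`).  This is the toleranced form of the classical gluing «every ball in the FCC or the HCP pattern ⇒ a
  walk through the triangle» [corpus:book:hales2012-dense-sphere-packings-blueprint-formal-proofs pp. 17–18, §1.3]; the clean class, local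
  optimality and unstrainedness of `CleanChartedW` play no role and are dropped (STRONGER, cleaner statement; TRUE-type · M · combinatorial
  local-to-global).  SEAM: `BarlowGluingW → CleanChartedW T₀ D` (instantiation).
* §3 the cone, **thirteenth form**: `rdef_of_grossU_shape_gluing (Λ) : GrossCleanBallsU (1/250) 10 → ChargedEnergyGap → CompressedVirialLaw (1/250) 10
  → TwoShellShape (1/100) (3/50) (1/450) → BarlowGluingW → DoorPeriodicW Λ → BalancedLayeredCleanW Λ → CleanlessExcessT → CoherentResidual 10 →
  RobustDefectLimitWindows`, through `rdef_of_grossU_localW_doorPeriodicW_balanced` (slot 4 entered at `LocalTwoShellRigidityW`, so that the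
  RT-currency `TightDozenRigidityW` and the lens-5-currency `TwoShellShape` both feed the same theorem).
No `sorry`, no new axioms, no `instance` / `notation`.
-/

noncomputable section

namespace Summit.AtomisticToContinuum.Crystallization.Theorems.OverbindingBudgetTwoShellShape

open scoped Classical
open MeasureTheory
open Literature.MathematicalPhysics.StatisticalMechanics (UniformlyDiscrete)
open Literature.Geometry.DiscreteGeometry (IsTwoShellGoodSet IsChargeFree bondGraph nearestDist nearestDist_le_dist le_nearestDist
  fccTwoShellPattern hcpTwoShellPattern)
open Summit.AtomisticToContinuum.Crystallization.Theses.OverbindingBudget (RobustDefectLimitWindows)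
open Summit.AtomisticToContinuum.Crystallization.Theses.PricedLinkCensus (ChargedEnergyGap)
open Summit.AtomisticToContinuum.Crystallization.Theorems.OverbindingBudgetGradedBareness (CleanlessExcessT)
open Summit.AtomisticToContinuum.Crystallization.Theorems.OverbindingBudgetCoherentCut (CoherentResidual)
open Summit.AtomisticToContinuum.Crystallization.Theorems.OverbindingBudgetUniformCutStatements (GrossCleanBallsU)
open Summit.AtomisticToContinuum.Crystallization.Theorems.OverbindingBudgetViolatorDensityFloor (RT)
open Summit.AtomisticToContinuum.Crystallization.Theorems.OverbindingBudgetEdgeRelaxationStatements (CleanClass)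
open Summit.AtomisticToContinuum.Crystallization.Theorems.OverbindingBudgetElasticSplitScale (HasCompressedScale CompressedVirialLaw)
open Summit.AtomisticToContinuum.Crystallization.Theorems.OverbindingBudgetElasticSplitPeriodic (rdef_of_grossU_periodicSplit)
open Summit.AtomisticToContinuum.Crystallization.Theorems.ChartedPlanarOrderRigidityDoor (IsCharted)
open Summit.AtomisticToContinuum.Crystallization.Theorems.ChartedPlanarOrderDensityDichotomy (μS)
open Summit.AtomisticToContinuum.Crystallization.Theorems.OverbindingBudgetTwoShellTransfer (IsTwoShellGoodSetGap sep_of_cleanClass)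
open Summit.AtomisticToContinuum.Crystallization.Theorems.OverbindingBudgetLimitChargeFreeBall (limitChargeFreeBall_holds)
open Summit.AtomisticToContinuum.Crystallization.Theorems.OverbindingBudgetRTDictionary (exists_eq_of_dist_lt_two mem_of_range)
open Summit.AtomisticToContinuum.Crystallization.Theorems.OverbindingBudgetPeriodicCleanOrStrained (periodicStrainedCubes_of_layered)
open Summit.AtomisticToContinuum.Crystallization.Theorems.OverbindingBudgetScaleWidening (TightDozenRigidityW LocalTwoShellRigidityW
  CleanTwoShellW CleanChartedW DoorPeriodicW BalancedLayeredCleanW cleanTwoShellW_of_ballPieces chargeFreeBallRigidityW_of_local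
  localTwoShellRigidityW_of_tightW optimalTexturePeriodic_of_doorPeriodicW layeredCleanOrStrained_of_balancedW)

/-! ## §1 Slot 4 in lens-5 / census currency: `TwoShellShape` -/

/-- **`TwoShellShape θ ε g`** — SCALE-FREE two-shell shape rigidity over finite configurations (lens-5 currency).  At a site `i` of an injective,
`7/10`-separated configuration `y : Fin N → E3` all of whose sites within `(5/2)·nearestDist y i` of `y i` are charge-free(`θ`), some linear
isometric image of the fcc or the hcp TWO-SHELL pattern, scaled by `nearestDist y i` and centred at `y i`, is matched injectively by sites within
`ε·nearestDist y i`, and every site `≠ y i` within `(3/2 + g)·nearestDist y i` is matched.  (First-shell shadow: lens-5's `KR2Shape`; caps: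
`Capped`/`CapForcing`; instrument: KR157 / TAG 160 at scale `nn_i`.)  Why it might fail: only through the cap deviation or the belt/coverage
clause at `θ = 1/100` (first-order margins ≈ ×3 at `ε = 3/50`); then `θ = 1/200` is the fallback literal. [UNDECIDED·TRUE-type; CERT] [piece] -/
def TwoShellShape (θ ε g : ℝ) : Prop :=
  ∀ (N : ℕ) (y : Fin N → EuclideanSpace ℝ (Fin 3)) (i : Fin N), Function.Injective y →
    (∀ a b : Fin N, a ≠ b → (7 : ℝ) / 10 ≤ dist (y a) (y b)) →
    (∀ i' : Fin N, dist (y i') (y i) ≤ 5 / 2 * nearestDist y i → IsChargeFree θ y i') →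
    ∃ (A : EuclideanSpace ℝ (Fin 3) →ₗᵢ[ℝ] EuclideanSpace ℝ (Fin 3)) (P : Finset (EuclideanSpace ℝ (Fin 3)))
      (f : EuclideanSpace ℝ (Fin 3) → EuclideanSpace ℝ (Fin 3)),
      (P = fccTwoShellPattern ∨ P = hcpTwoShellPattern) ∧
      (∀ v ∈ P, f v ∈ Set.range y ∧ dist (f v) (y i + nearestDist y i • A v) ≤ ε * nearestDist y i) ∧ Set.InjOn f ↑P ∧
      ∀ k : Fin N, k ≠ i → dist (y k) (y i) ≤ (3 / 2 + g) * nearestDist y i → ∃ v ∈ P, f v = y k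

/-- **SEAM, PROVED** (`T₀ ≤ 1/250`): `TwoShellShape (1/100) (3/50) (1/450) → LocalTwoShellRigidityW T₀ D`.  The clean class pins the
nearest distance of a deep chunk site into `[47·49/2500 − T₀, 51/50 + T₀] ⊂ [9/10, 103/100]`, separates chunk sites by `≥ 7/10`, makes
`(5/2)·nn ≤ 3`, and `1/500 ≤ nn/450`; sites of `Y` within `3/2·nn + 1/500` of a `7`-deep chunk site are chunk sites. [this file] -/
theorem localTwoShellRigidityW_of_twoShellShape {T₀ D : ℝ} (hT : T₀ ≤ 1 / 250)
    (h : TwoShellShape (1 / 100) (3 / 50) (1 / 450)) : LocalTwoShellRigidityW T₀ D := by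
  intro Y hY _hnc c ℓ N y i hy hr hdeep hcf3
  have hsepY := sep_of_cleanClass hY
  obtain ⟨a, ha, ha1, hRT⟩ := hY.2.2.2.2.2
  have hyi : y i ∈ Y := mem_of_range hr i
  have hdeep2 : ∀ j : Fin 3, c j + 2 ≤ y i j ∧ y i j + 2 ≤ c j + ℓ := by
    intro j; obtain ⟨h1, h2⟩ := hdeep j; constructor <;> linarith
  -- a second chunk site within `a (1 + 1/50) + T₀` of `y i`
  have hne : ({w ∈ Y | w ≠ y i ∧ dist (y i) w ≤ a * (1 + 1 / 50) + T₀}).Nonempty := by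
    apply Set.nonempty_of_ncard_ne_zero
    have h12 := (hRT (y i) hyi).2.1
    omega
  obtain ⟨w, hwY, hwne, hwd⟩ := hne
  obtain ⟨k, rfl⟩ := exists_eq_of_dist_lt_two hr hdeep2 hwY (by nlinarith)
  have hki : k ≠ i := fun e => hwne (by rw [e])
  -- the nearest distance of `i` lies in `[9/10, 103/100]`
  have hnn_le : nearestDist y i ≤ 103 / 100 := (nearestDist_le_dist y hki).trans (by nlinarith)
  have hnn_ge : 9 / 10 ≤ nearestDist y i := by
    refine le_nearestDist ⟨k, hki⟩ fun m hm => ?_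
    have := hsepY (y i) hyi (y m) (mem_of_range hr m) (fun e => hm (hy e).symm)
    linarith
  have hsep7 : ∀ a b : Fin N, a ≠ b → (7 : ℝ) / 10 ≤ dist (y a) (y b) := by
    intro a' b' hab
    have := hsepY (y a') (mem_of_range hr a') (y b') (mem_of_range hr b') (fun e => hab (hy e))
    linarith
  have hcf : ∀ i' : Fin N, dist (y i') (y i) ≤ 5 / 2 * nearestDist y i → IsChargeFree (1 / 100 : ℝ) y i' :=
    fun i' hi' => hcf3 i' (by nlinarith)
  obtain ⟨A, P, f, hP, hf, hinj, hcov⟩ := h N y i hy hsep7 hcf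
  refine ⟨nearestDist y i, hnn_ge, hnn_le, A, P, f, hP, fun v hv => ⟨?_, (hf v hv).2⟩, hinj, ?_⟩
  · obtain ⟨m, hm⟩ := (hf v hv).1
    rw [← hm]; exact mem_of_range hr m
  · intro y' hy' hne' hd
    obtain ⟨m, rfl⟩ := exists_eq_of_dist_lt_two hr hdeep2 hy' (by rw [dist_comm]; nlinarith)
    have hmi : m ≠ i := fun e => hne' (by rw [e])
    exact hcov m hmi (by nlinarith)

/-! ## §2 Slot 5 class-free: `BarlowGluingW` -/

/-- **`BarlowGluingW`** — TOLERANCED BARLOW GLUING: a rooted, uniformly discrete set each of whose sites is `(1/16, 9/10, 103/100)`-two-shell-good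
(fcc or hcp 18-point pattern within `a/16`, covering the `3a/2`-ball) is Barlow-bond-charted: its `(0, 28/25]`-bond graph is isomorphic to the
contact graph of a Barlow stacking `barlowStacking 1 √(2/3) s` with a Hägg word `s`.  (Exact-contact original: every ball in the FCC or the HCP
pattern ⇒ a walk through the triangle — hcp-type sites propagate along their symmetry plane to a full hexagonal layer, which forces the layers
above and below [hales2012 blueprint §1.3, pp. 17–18]; with tolerance `1/16` the bond graph still equals the union of the local pattern contacts
(`17/16·103/100 < 28/25 < (√2 − 1/16)·9/10`).)  Why it might fail: a tolerance-level ambiguity of the fcc/hcp TYPE of a site is excluded by the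
pattern hypothesis itself, so only a GLOBAL obstruction (an hcp-type symmetry plane failing to propagate through a region of fcc-type sites)
could — the classical argument says it cannot. [TRUE-type · M · combinatorial local-to-global; STRONGER than `CleanChartedW`] [piece] -/
def BarlowGluingW : Prop :=
  ∀ Y : Set (EuclideanSpace ℝ (Fin 3)), (0 : EuclideanSpace ℝ (Fin 3)) ∈ Y → UniformlyDiscrete Y →
    (∀ q ∈ Y, IsTwoShellGoodSet (1 / 16) (9 / 10) (103 / 100) Y q) → IsCharted (μS Y)

/-- **SEAM.** `BarlowGluingW → CleanChartedW T₀ D` (the clean class supplies the root and uniform discreteness; nothing else is used). [this file] -/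
theorem cleanChartedW_of_gluing {T₀ D : ℝ} (h : BarlowGluingW) : CleanChartedW T₀ D :=
  fun Y hY _ _ _ _ h2 => h Y hY.2.1 hY.1 h2

/-! ## §3 The cone, thirteenth form -/

/-- RDEF cone with slot 4 entered at `LocalTwoShellRigidityW` (both slot-4 currencies feed this). [this file] -/
theorem rdef_of_grossU_localW_doorPeriodicW_balanced (Λ : ℝ) (hG : GrossCleanBallsU (1 / 250) 10) (hCEG : ChargedEnergyGap)
    (hC : CompressedVirialLaw (1 / 250) 10) (hL : LocalTwoShellRigidityW (1 / 250) 10) (h₂ : CleanChartedW (1 / 250) 10)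
    (hD : DoorPeriodicW Λ) (hB : BalancedLayeredCleanW Λ) (hCE : CleanlessExcessT) (hR : CoherentResidual 10) :
    RobustDefectLimitWindows :=
  have h₁ : CleanTwoShellW (1 / 250) 10 :=
    cleanTwoShellW_of_ballPieces (limitChargeFreeBall_holds (1 / 250) 10) (chargeFreeBallRigidityW_of_local (by norm_num) hL)
  rdef_of_grossU_periodicSplit Λ hG hCEG hC (optimalTexturePeriodic_of_doorPeriodicW h₁ h₂ hD)
    (periodicStrainedCubes_of_layered (by norm_num) (layeredCleanOrStrained_of_balancedW (by norm_num) h₁ hB)) hCE hR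

/-- **RDEF cone, thirteenth form** (every `Λ`; slots 4 and 5 in the other seats' currencies): `GrossCleanBallsU (1/250) 10 → ChargedEnergyGap →
CompressedVirialLaw (1/250) 10 → TwoShellShape (1/100) (3/50) (1/450) → BarlowGluingW → DoorPeriodicW Λ → BalancedLayeredCleanW Λ →
CleanlessExcessT → CoherentResidual 10 → RobustDefectLimitWindows`. [this file] -/
theorem rdef_of_grossU_shape_gluing (Λ : ℝ) (hG : GrossCleanBallsU (1 / 250) 10) (hCEG : ChargedEnergyGap)
    (hC : CompressedVirialLaw (1 / 250) 10) (hS : TwoShellShape (1 / 100) (3 / 50) (1 / 450)) (hB₂ : BarlowGluingW) (hD : DoorPeriodicW Λ)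
    (hB : BalancedLayeredCleanW Λ) (hCE : CleanlessExcessT) (hR : CoherentResidual 10) : RobustDefectLimitWindows :=
  rdef_of_grossU_localW_doorPeriodicW_balanced Λ hG hCEG hC (localTwoShellRigidityW_of_twoShellShape (by norm_num) hS)
    (cleanChartedW_of_gluing hB₂) hD hB hCE hR

/-- The RT-currency slot 4 (`TightDozenRigidityW`) with the class-free slot 5. [this file] -/
theorem rdef_of_grossU_tightW_gluing (Λ : ℝ) (hG : GrossCleanBallsU (1 / 250) 10) (hCEG : ChargedEnergyGap)
    (hC : CompressedVirialLaw (1 / 250) 10) (hK : TightDozenRigidityW (1 / 250)) (hB₂ : BarlowGluingW) (hD : DoorPeriodicW Λ)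
    (hB : BalancedLayeredCleanW Λ) (hCE : CleanlessExcessT) (hR : CoherentResidual 10) : RobustDefectLimitWindows :=
  rdef_of_grossU_localW_doorPeriodicW_balanced Λ hG hCEG hC (localTwoShellRigidityW_of_tightW (by norm_num) (by norm_num) hK)
    (cleanChartedW_of_gluing hB₂) hD hB hCE hR

end Summit.AtomisticToContinuum.Crystallization.Theorems.OverbindingBudgetTwoShellShape

end
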